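import Literature.Topology.FourManifolds.LeftHandDiscSlab
import Literature.Topology.FourManifolds.BoxFlatDiscs
import Literature.AlgebraicTopology.SingularHomology.TransverseDiscFunctional
import HarnessLib

/-!
# A continuous normal coordinate to the left-hand disc of a critical point across a slab, and
# the transverse flat disc: the `TransverseDiscDatum` of Milnor's Lemma 7.2

Topic `Literature/Topology/FourManifolds`; the geometric brick for the fact seat
`provefact-Literature.Topology.FourManifolds.Cobordism.Milnor1965_intersectionNumber_slab`
(Milnor, *Lectures on the h-cobordism theorem* (1965), Lemma 7.2 / Lemma 6.3 in the tree's
homological form, `Literature.Topology.FourManifolds.Cobordism.Milnor1965_intersectionNumber_slab_of_sphereClass`).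
Milnor proves Lemma 7.2 by localising `H_λ(W, V)` at the disc `D = D_R(q)` swept by the critical
point through the slab and computing there with the Thom class of its normal bundle (Lemma 6.2,
PDF p. 37) and Def. 3.1's coordinates (*"`f = f(p) - |x⃗|² + |y⃗|²`"*, PDF p. 12; the disc is a
coordinate plane in the Morse chart and a union of trajectories outside it, Def. 3.9, PDF p. 16).
The tree has no Thom isomorphism; `…TransverseDiscFunctional` replaces it by a *transverse disc
functional*, whose input this file constructs in the setting
`Literature.Topology.FourManifolds.Cobordism.LeftSphereSetting` `S` of `LeftHandSphereFlow.lean`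
(turned-about form: the critical point `q` lies *above* the level `b`; the disc is the left-hand
disc `P = D_L(q) = stableSet ξ q ∩ {b ≤ f}`, the transverse disc is a flat piece of the right-hand
disc `{x⃗ = 0}`; the original Lemma 7.2 is this for `(1 - f, -ξ)`):

* `LeftSphereSetting.normalRegion` `N` — an open neighbourhood of `P` in the slab
  `X = f⁻¹[b, t₁]` (`f q < t₁`): below the level `V₋ε = f⁻¹(b')`, the points whose translate
  to `V₋ε` along the trajectories lies in the chart region of Def. 3.9's product neighbourhood
  (`LeftSphereSetting.chartRegion`, `LeftHandSphereEmbedding.lean`); above it, the points of a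
  small Milnor ball;
* `LeftSphereSetting.normalCoordW` — the **normal coordinate** `K = y⃗ ∘ (translate to V₋ε)`
  below `V₋ε` and `K = y⃗` above it (`y⃗ = upperProj`, the expanding Milnor coordinates),
  continuous on `N` (the two formulas agree on `V₋ε`), vanishing exactly on `P`
  (`normalCoordW_eq_zero_iff`: in the box the stable set is `y⃗ = 0`,
  `LeftSphereSetting.exists_discPoint_eq_of_mem_stableSet`, and stable sets are flow invariant,
  `PreSlabFlow.apply_mem_stableSet_iff`); on the lower level `b` it is, by definition, the
  normal component of Milnor's characteristic embedding `φ_L` read backwards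
  (`LeftSphereSetting.paramInv`), `snd_paramInv`;
* `LeftSphereSetting.flatPoint` — the **transverse flat disc** `y ↦ ψ(0, y)` (`‖y‖ ≤ r`), a
  parametrized disc of the unstable set of `q` through `q` on which `K` is the identity;
* **`LeftSphereSetting.transverseDiscDatum`** — the resulting
  `Literature.AlgebraicTopology.SingularHomology.TransverseDiscDatum` on `X`, with the facts the
  functional's evaluation theorems consume: `disc_subset_unstableSet`,
  `disc_mem_nhdsWithin` (the flat disc is a neighbourhood of `q` in the unstable set),
  `eq_centre_of_mem_unstableSet_of_mem_P` (`D_L ∩ D_R = {q}`), `K_flatPoint` (`K ∘ m = id`),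
  `mem_N_iff_of_apply_lt`, `K_apply_of_apply_le` (the form of `N`, `K` near the level `b`).

Everything here is proved; the definitions are the explicit maps and sets listed (and the radial
clipping `radialClip`).

## References

* J. Milnor, *Lectures on the h-cobordism theorem*, notes by L. Siebenmann and J. Sondow,
  Princeton Mathematical Notes (1965): Def. 3.1 (PDF pp. 11–12), Def. 3.9 (PDF p. 16), proof of
  Thm. 3.12 (PDF p. 18), Lemma 6.2, Lemma 6.3 (PDF p. 37), Lemma 7.2 and its proof (PDF pp. 46–48).
  Held: `lit read book:milnornd-lectures-h-cobordism-theorem`. [MilnorHCobordism1965]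
-/

open scoped Manifold ContDiff Topology
open Set Function Filter Metric
open Literature.AlgebraicTopology.SingularHomology

noncomputable section

namespace Literature.Topology.FourManifolds

universe u

/-! ### Radial clipping onto a closed ball -/

section Clip

variable {E : Type*} [NormedAddCommGroup E] [NormedSpace ℝ E]

/-- **Radial clipping** of a real normed space onto the closed ball of radius `r`:
`v ↦ (r / max r ‖v‖) • v` (the identity on the ball, radial outside). [folklore] -/
def radialClip (r : ℝ) (v : E) : E := (r / max r ‖v‖) • v

/-- `radialClip` is continuous for `r > 0`. [folklore] -/
theorem continuous_radialClip {r : ℝ} (hr : 0 < r) : Continuous (radialClip (E := E) r) := by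
  refine Continuous.smul (continuous_const.div (continuous_const.max continuous_norm) fun v => ?_) continuous_id
  exact (lt_max_of_lt_left hr).ne'

/-- On the closed ball `radialClip` is the identity. [folklore] -/
theorem radialClip_of_norm_le {r : ℝ} (hr : 0 < r) {v : E} (hv : ‖v‖ ≤ r) : radialClip r v = v := by
  rw [radialClip, max_eq_left hv, div_self hr.ne', one_smul]

/-- `‖radialClip r v‖ ≤ r` (`r > 0`). [folklore] -/
theorem norm_radialClip_le {r : ℝ} (hr : 0 < r) (v : E) : ‖radialClip r v‖ ≤ r := by
  rw [radialClip, norm_smul, Real.norm_eq_abs, abs_of_pos (div_pos hr (lt_max_of_lt_left hr))]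
  rcases le_or_gt ‖v‖ r with h | h
  · rw [max_eq_left h, div_self hr.ne', one_mul]; exact h
  · rw [max_eq_right h.le, div_mul_cancel₀ _ (hr.trans h).ne']

/-- `radialClip r v = 0 ↔ v = 0` (`r > 0`). [folklore] -/
theorem radialClip_eq_zero_iff {r : ℝ} (hr : 0 < r) {v : E} : radialClip r v = 0 ↔ v = 0 := by
  rw [radialClip, smul_eq_zero, or_iff_right]
  exact (div_pos hr (lt_max_of_lt_left hr)).ne'

/-- Near `0`, `radialClip r` is the identity (`r > 0`). [folklore] -/
theorem radialClip_eventuallyEq_id {r : ℝ} (hr : 0 < r) : radialClip (E := E) r =ᶠ[𝓝 0] id := by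
  filter_upwards [Metric.ball_mem_nhds (0 : E) hr] with v hv
  exact radialClip_of_norm_le hr (mem_ball_zero_iff.1 hv).le

/-- `radialClip r v` lies in the closed ball of radius `r` (`r > 0`). [folklore] -/
theorem radialClip_mem_closedBall {r : ℝ} (hr : 0 < r) (v : E) : radialClip r v ∈ closedBall (0 : E) r :=
  mem_closedBall_zero_iff.2 (norm_radialClip_le hr v)

end Clip

/-! ### Milnor coordinates: the expanding part in any dimension `l`, `(k + 1) + l = n + 1` -/

section Coordinates

variable {K L m : ℕ}

/-- `|y⃗|² = ‖upperProj u‖²` when `K + L = m`. [folklore] -/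
theorem sqSumGE_eq_norm_upperProj_sq (hm : K + L = m) (u : EuclideanSpace ℝ (Fin m)) :
    sqSumGE K u = ‖upperProj K L m u‖ ^ 2 := by
  conv_lhs => rw [← lowerEmb_lowerProj_add_upperEmb_upperProj hm u]
  exact sqSumGE_lowerEmb_add_upperEmb hm _ _

/-- `|x⃗|² = ‖lowerProj u‖²` when `K + L = m`. [folklore] -/
theorem sqSumLT_eq_norm_lowerProj_sq (hm : K + L = m) (u : EuclideanSpace ℝ (Fin m)) :
    sqSumLT K u = ‖lowerProj K m u‖ ^ 2 := by
  conv_lhs => rw [← lowerEmb_lowerProj_add_upperEmb_upperProj hm u]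
  exact sqSumLT_lowerEmb_add_upperEmb (by omega) _ _

/-- `|y⃗|² = 0 ↔ y⃗ = 0`. [folklore] -/
theorem sqSumGE_eq_zero_iff_upperProj (hm : K + L = m) (u : EuclideanSpace ℝ (Fin m)) :
    sqSumGE K u = 0 ↔ upperProj K L m u = 0 := by
  rw [sqSumGE_eq_norm_upperProj_sq hm, sq_eq_zero_iff, norm_eq_zero]

/-- A vector with `|x⃗|² = 0` is `(0, y⃗)`. [folklore] -/
theorem eq_upperEmb_of_sqSumLT_eq_zero (hm : K + L = m) {u : EuclideanSpace ℝ (Fin m)} (hu : sqSumLT K u = 0) :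
    u = upperEmb K L m (upperProj K L m u) := by
  have h0 : lowerProj K m u = 0 := by
    rw [sqSumLT_eq_norm_lowerProj_sq hm, sq_eq_zero_iff, norm_eq_zero] at hu
    exact hu
  conv_lhs => rw [← lowerEmb_lowerProj_add_upperEmb_upperProj hm u, h0, map_zero, zero_add]

/-- `(0, y⃗)` has `|x⃗|² = 0`, `|y⃗|² = ‖y‖²`, `Q = ‖y‖²`. [folklore] -/
theorem sqSumLT_upperEmb (hm : K + L = m) (y : EuclideanSpace ℝ (Fin L)) : sqSumLT K (upperEmb K L m y) = 0 := by
  have h := sqSumLT_lowerEmb_add_upperEmb (K := K) (L := L) (m := m) (by omega) 0 y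
  rwa [map_zero, zero_add, norm_zero, zero_pow two_ne_zero] at h

/-- See `sqSumLT_upperEmb`. [folklore] -/
theorem sqSumGE_upperEmb (hm : K + L = m) (y : EuclideanSpace ℝ (Fin L)) :
    sqSumGE K (upperEmb K L m y) = ‖y‖ ^ 2 := by
  have h := sqSumGE_lowerEmb_add_upperEmb (K := K) (L := L) (m := m) hm 0 y
  rwa [map_zero, zero_add] at h

/-- See `sqSumLT_upperEmb`. [folklore] -/
theorem milnorQuadratic_upperEmb (hm : K + L = m) (y : EuclideanSpace ℝ (Fin L)) :
    milnorQuadratic K (upperEmb K L m y) = ‖y‖ ^ 2 := by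
  rw [milnorQuadratic_eq, sqSumLT_upperEmb hm, sqSumGE_upperEmb hm, neg_zero, zero_add]

end Coordinates

/-! ### The setting -/

section Setting

variable {n : ℕ} {M N : Type u} [TopologicalSpace M] [ChartedSpace (EuclideanSpace ℝ (Fin n)) M]
  [TopologicalSpace N] [ChartedSpace (EuclideanSpace ℝ (Fin n)) N]

namespace Cobordism

namespace LeftSphereSetting

open FourManifolds.Flow

variable {c : Cobordism n M N} {f : c.W → ℝ} {ξ : Π x : c.W, TangentSpace (𝓡∂ (n + 1)) x}
  {k : ℕ} (S : LeftSphereSetting c f ξ k) {l : ℕ}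

/-- Local notation for the model of the expanding coordinates. -/
local notation "𝔼ˡ" => EuclideanSpace ℝ (Fin l)

/-! #### Elementary facts about the box and the chart points -/

/-- `ψ 0 = q`. [folklore] -/
theorem chartPoint_zero : S.chartPoint 0 = S.q := S.box.symm_add_zero

/-- `ψ(lowerEmb x)` (`‖x‖ < 3ε`) lies on a trajectory going to `q`. [cite: MilnorHCobordism1965, proof of Thm. 3.12 (PDF p. 18)] -/
theorem tendsto_chartPoint_lowerEmb {x : EuclideanSpace ℝ (Fin (k + 1))} (hx : ‖x‖ < 3 * S.ε) :
    Tendsto (fun t => S.θ (t, S.chartPoint (lowerEmb (k + 1) (n + 1) x))) atTop (𝓝 S.q) :=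
  S.box.tendsto_flow_symm_add S.isSmoothFlow S.pre.contMDiff_slabField (S.contracting_lowerEmb x)
    (by rw [norm_lowerEmb S.succ_le]; exact hx)

/-- **In the chart, `y⃗ = 0` means: on a trajectory going to `q`** (the points `ψ(x⃗, 0)`,
`‖x⃗‖ < 3ε`, of a chart domain inside the open slab). [cite: MilnorHCobordism1965, Def. 3.1 (2) (PDF p. 12), Def. 3.9 (PDF p. 16)] -/
theorem mem_stableSet_of_sqSumGE_eq_zero (hD : S.box.chart.source ⊆ f ⁻¹' Ioo S.a₀ S.a₁) {w : c.W} (hw : w ∈ S.box.chart.source)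
    (hw3 : ‖S.box.coord w‖ < 3 * S.ε) (h0 : sqSumGE (k + 1) (S.box.coord w) = 0) :
    w ∈ stableSet (𝓡∂ (n + 1)) ξ S.q := by
  set u := S.box.coord w with hu
  have hu' : u = lowerEmb (k + 1) (n + 1) (lowerProj (k + 1) (n + 1) u) :=
    (lowerEmb_lowerProj_of_sqSumGE_eq_zero h0).symm
  have hx : ‖lowerProj (k + 1) (n + 1) u‖ < 3 * S.ε := by
    rw [← norm_lowerEmb S.succ_le, ← hu']; exact hw3
  have hwpt : w = S.chartPoint (lowerEmb (k + 1) (n + 1) (lowerProj (k + 1) (n + 1) u)) := by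
    rw [← hu']; exact (S.chartPoint_coord hw).symm
  have hfw : S.a₀ ≤ f w := (hD hw).1.le
  rw [S.pre.mem_stableSet_iff_tendsto hfw S.apply_le, hwpt]
  exact S.tendsto_chartPoint_lowerEmb hx

/-- **Points of the stable set above `V₋ε` have `y⃗ = 0`, `‖(x⃗, y⃗)‖ ≤ ε`, in the chart**
(they are points `ψ(ε v, 0)`, `‖v‖ ≤ 1`, of the top disc). [cite: MilnorHCobordism1965, Def. 3.9 (PDF p. 16), proof of Thm. 3.12 (PDF p. 18)] -/
theorem coord_of_mem_stableSet {w : c.W} (hw : w ∈ stableSet (𝓡∂ (n + 1)) ξ S.q) (hwb : S.b' ≤ f w) :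
    w ∈ S.box.chart.source ∧ sqSumGE (k + 1) (S.box.coord w) = 0 ∧ ‖S.box.coord w‖ ≤ S.ε := by
  obtain ⟨v, hv, rfl⟩ := S.exists_discPoint_eq_of_mem_stableSet hw hwb
  have h3 := S.norm_lowerEmb_smul_lt hv
  refine ⟨S.chartPoint_mem_source h3.le, ?_, ?_⟩
  · rw [discPoint, S.coord_chartPoint h3.le]
    exact sqSumGE_of_contracting (milnorModelField_lowerEmb _)
  · rw [discPoint, S.coord_chartPoint h3.le, S.norm_lowerEmb_smul]
    nlinarith [S.eps_pos, norm_nonneg v]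

/-- **`D_L(q) ∩ D_R(q) = {q}`**: a point on a trajectory going to `q` and on one coming from `q`
is `q` (`f` increases strictly along non-constant trajectories). [cite: MilnorHCobordism1965, Def. 3.1 (1), Def. 3.9 (PDF pp. 12, 16)] -/
theorem eq_q_of_mem_stableSet_of_mem_unstableSet {x : c.W} (hxs : x ∈ stableSet (𝓡∂ (n + 1)) ξ S.q)
    (hxu : x ∈ unstableSet (𝓡∂ (n + 1)) ξ S.q) (hxa : S.a₀ ≤ f x) : x = S.q := by
  by_contra hxq
  have h1 : f S.q ≤ f x :=
    S.slabFlow.isGradientLike.apply_le_of_mem_unstableSet S.mdifferentiable_f hxu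
  have h2 := S.apply_flow_lt_apply_flow hxs hxq hxa le_rfl zero_lt_one
  rw [S.isSmoothFlow.map_zero] at h2
  have h3 : S.θ (1, x) ∈ stableSet (𝓡∂ (n + 1)) ξ S.q :=
    (S.pre.apply_mem_stableSet_iff hxa (S.pre.le_apply_of_nonneg hxa zero_le_one) S.apply_le).2 hxs
  have h4 : f (S.θ (1, x)) ≤ f S.q := S.apply_le_of_mem_stableSet h3
  linarith

/-! #### The level `V₋ε = f⁻¹(b')` and the translation to it -/

/-- No critical value lies in `[t, b']` for `b ≤ t`. [folklore] -/
theorem not_mem_Icc_of_le {z : c.W} (hz : IsMCriticalPt (𝓡∂ (n + 1)) f z) {t : ℝ} (ht : S.b ≤ t) :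
    f z ∉ Icc t S.b' := fun h => S.not_mem_Ico z hz ⟨ht.trans h.1, h.2.trans_lt S.b'_lt⟩

/-- **Every point with `f ∈ [b, b']` reaches `V₋ε` forwards.** [cite: MilnorHCobordism1965, Def. 3.9 (PDF p. 16), Thm. 4.1 (PDF p. 22)] -/
theorem hits_b' {z : c.W} (hz : f z ∈ Icc S.b S.b') : Hits S.θ f S.b' z := by
  obtain ⟨t, -, ht⟩ := S.pre.exists_apply_eq_of_forall_not_mem_Icc (x := z) (b' := S.b')
    (S.lt_b.le.trans hz.1) hz.2 S.b'_lt_a₁ (fun p hp => S.not_mem_Icc_of_le hp hz.1)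
  exact ⟨t, ht⟩

/-- The translate to `V₋ε` lies on `V₋ε`. [folklore] -/
theorem apply_levelProj_b' {z : c.W} (hz : f z ∈ Icc S.b S.b') : f (levelProj S.θ f S.b' z) = S.b' :=
  apply_hittingTime (S.hits_b' hz)

/-- The translation to `V₋ε` is continuous at the points with `f ∈ [b, b']`. [cite: MilnorHCobordism1965, Thm. 4.1 (PDF p. 22)] -/
theorem continuousAt_levelProj_b' {z : c.W} (hz : f z ∈ Icc S.b S.b') :
    ContinuousAt (levelProj S.θ f S.b') z :=
  (S.slabFlow.contMDiffAt_levelProj S.b'_mem_Icc S.not_isMCriticalPt_of_apply_eq_b'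
    ⟨S.lt_b.le.trans hz.1, hz.2.trans S.b'_lt_a₁.le⟩ (S.hits_b' hz)).continuousAt

/-- On `V₋ε` the translation is the identity. [folklore] -/
theorem levelProj_b'_of_apply_eq {z : c.W} (hz : f z = S.b') : levelProj S.θ f S.b' z = z := by
  have h := S.isSmoothFlow.levelProj_apply_of_apply_eq S.mdifferentiable_f S.transversal_b' hz 0
  rwa [S.isSmoothFlow.map_zero] at h

/-- **Stable sets are invariant under the translation to `V₋ε`.** [cite: MilnorHCobordism1965, Def. 3.9 (PDF p. 16), Thm. 4.1 (PDF p. 22)] -/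
theorem levelProj_b'_mem_stableSet_iff {z : c.W} (hz : f z ∈ Icc S.b S.b') :
    levelProj S.θ f S.b' z ∈ stableSet (𝓡∂ (n + 1)) ξ S.q ↔ z ∈ stableSet (𝓡∂ (n + 1)) ξ S.q := by
  have h : S.a₀ ≤ f (levelProj S.θ f S.b' z) := by rw [S.apply_levelProj_b' hz]; exact S.a₀_lt_b'.le
  exact S.pre.apply_mem_stableSet_iff (S.lt_b.le.trans hz.1) h S.apply_le

/-- **A point of the stable set with `f ∈ [b, b']` translates into the chart region** (its
translate is a point `φ(u, 0)` of the sphere `S_L(b')`). [cite: MilnorHCobordism1965, Def. 3.9 (PDF p. 16)] -/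
theorem levelProj_b'_mem_chartRegion {z : c.W} (hz : f z ∈ Icc S.b S.b')
    (hzs : z ∈ stableSet (𝓡∂ (n + 1)) ξ S.q) : levelProj S.θ f S.b' z ∈ S.chartRegion := by
  have hw := (S.levelProj_b'_mem_stableSet_iff hz).2 hzs
  obtain ⟨hsrc, h0, hε⟩ := S.coord_of_mem_stableSet hw (S.apply_levelProj_b' hz).ge
  refine ⟨hsrc, ?_, by linarith [S.eps_pos]⟩
  rw [(sqSumGE_eq_zero_iff_upperProj S.dim_eq _).1 h0, norm_zero]
  exact S.eps_pos

/-! #### The neighbourhood `N` and the normal coordinate -/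

variable (t₁ : ℝ)

/-- The slab `X = f⁻¹[b, t₁]`. [folklore] -/
abbrev slab : Type u := ↥(f ⁻¹' Icc S.b t₁)

/-- **The region `N ⊆ W` of the normal coordinate**: below `V₋ε`, the points whose translate to
`V₋ε` lies in the chart region of the product neighbourhood (`LeftSphereSetting.chartRegion`);
above `V₋ε`, the points of the Milnor ball `‖(x⃗, y⃗)‖ < 2ε`. [cite: MilnorHCobordism1965, Def. 3.9 (PDF p. 16), proof of Lemma 7.2 (PDF p. 47)] -/
def normalRegionW : Set c.W :=
  {z | (f z ≤ S.b' → levelProj S.θ f S.b' z ∈ S.chartRegion) ∧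
    (S.b' ≤ f z → z ∈ S.box.chart.source ∧ ‖S.box.coord z‖ < 2 * S.ε)}

/-- `N` on the slab. [folklore] -/
def normalRegion : Set (S.slab t₁) := Subtype.val ⁻¹' S.normalRegionW

/-- **The point read in the chart**: the translate to `V₋ε` below `V₋ε`, the point itself above. [cite: MilnorHCobordism1965, Def. 3.9 (PDF p. 16)] -/
def chartOf (z : c.W) : c.W := if f z ≤ S.b' then levelProj S.θ f S.b' z else z

/-- **The normal coordinate `y⃗` on `W`** (junk outside `N`): the expanding Milnor coordinates of
`chartOf z`, in dimension `l` (`(k + 1) + l = n + 1`). [cite: MilnorHCobordism1965, Def. 3.1 (2) (PDF p. 12), proof of Lemma 7.2 (PDF p. 47)] -/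
def normalCoordW (z : c.W) : 𝔼ˡ := upperProj (k + 1) l (n + 1) (S.box.coord (S.chartOf z))

variable {t₁}

/-- `chartOf z` lies in the chart domain for `z ∈ N`. [folklore] -/
theorem chartOf_mem_source {z : c.W} (hz : z ∈ S.normalRegionW) : S.chartOf z ∈ S.box.chart.source := by
  unfold chartOf
  split_ifs with h
  · exact (hz.1 h).1
  · exact (hz.2 (not_le.1 h).le).1

/-- Below `V₋ε`, `chartOf` is the translation. [folklore] -/
theorem chartOf_of_le {z : c.W} (hz : f z ≤ S.b') : S.chartOf z = levelProj S.θ f S.b' z := if_pos hz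

/-- Above `V₋ε`, `chartOf` is the identity. [folklore] -/
theorem chartOf_of_lt {z : c.W} (hz : S.b' < f z) : S.chartOf z = z := if_neg (not_le.2 hz)

/-- **`chartOf` is continuous on `N ∩ {b ≤ f}`** (the two branches agree on `V₋ε`). [cite: MilnorHCobordism1965, Thm. 4.1 (PDF p. 22)] -/
theorem continuousOn_chartOf : ContinuousOn S.chartOf (S.normalRegionW ∩ {z | S.b ≤ f z}) := by
  have hfc : Continuous f := S.contMDiff_f.continuous
  refine ContinuousOn.if ?_ ?_ continuousOn_id
  · rintro a ⟨-, ha⟩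
    have ha' : f a = S.b' := frontier_le_subset_eq hfc continuous_const ha
    exact S.levelProj_b'_of_apply_eq ha'
  · rintro a ⟨⟨-, hab⟩, ha⟩
    have hcl : closure {z : c.W | f z ≤ S.b'} = {z | f z ≤ S.b'} := (isClosed_le hfc continuous_const).closure_eq
    rw [hcl] at ha
    exact (S.continuousAt_levelProj_b' ⟨hab, ha⟩).continuousWithinAt

/-- **The normal coordinate is continuous on `N ∩ {b ≤ f}`.** [cite: MilnorHCobordism1965, proof of Lemma 7.2 (PDF p. 47)] -/
theorem continuousOn_normalCoordW : ContinuousOn (S.normalCoordW (l := l)) (S.normalRegionW ∩ {z | S.b ≤ f z}) := by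
  refine (upperProj (k + 1) l (n + 1)).continuous.comp_continuousOn
    (S.box.continuousOn_coord.comp S.continuousOn_chartOf fun z hz => S.chartOf_mem_source hz.1)

/-- **The zero set of the normal coordinate is the stable set** (on `N ∩ {b ≤ f}`, chart domain in
the open slab, `(k + 1) + l = n + 1`). [cite: MilnorHCobordism1965, Def. 3.1 (2) (PDF p. 12), Def. 3.9 (PDF p. 16)] -/
theorem normalCoordW_eq_zero_iff (hD : S.box.chart.source ⊆ f ⁻¹' Ioo S.a₀ S.a₁) (hl : k + 1 + l = n + 1) {z : c.W}
    (hz : z ∈ S.normalRegionW) (hzb : S.b ≤ f z) :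
    S.normalCoordW (l := l) z = 0 ↔ z ∈ stableSet (𝓡∂ (n + 1)) ξ S.q := by
  rw [normalCoordW, ← sqSumGE_eq_zero_iff_upperProj hl]
  by_cases hle : f z ≤ S.b'
  · have hzI : f z ∈ Icc S.b S.b' := ⟨hzb, hle⟩
    rw [S.chartOf_of_le hle, ← S.levelProj_b'_mem_stableSet_iff hzI]
    have hw := hz.1 hle
    constructor
    · intro h0
      exact S.mem_stableSet_of_sqSumGE_eq_zero hD hw.1 hw.2.2 h0
    · intro hws
      exact (S.coord_of_mem_stableSet hws (S.apply_levelProj_b' hzI).ge).2.1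
  · have hlt : S.b' < f z := not_le.1 hle
    rw [S.chartOf_of_lt hlt]
    have hw := hz.2 hlt.le
    constructor
    · intro h0
      exact S.mem_stableSet_of_sqSumGE_eq_zero hD hw.1 (by linarith [hw.2, S.eps_pos]) h0
    · intro hws
      exact (S.coord_of_mem_stableSet hws hlt.le).2.1

/-- **The stable set lies in `N`** (on `{b ≤ f}`). [cite: MilnorHCobordism1965, Def. 3.9 (PDF p. 16)] -/
theorem mem_normalRegionW_of_mem_stableSet {z : c.W} (hzs : z ∈ stableSet (𝓡∂ (n + 1)) ξ S.q) (hzb : S.b ≤ f z) :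
    z ∈ S.normalRegionW := by
  refine ⟨fun hle => S.levelProj_b'_mem_chartRegion ⟨hzb, hle⟩ hzs, fun hge => ?_⟩
  obtain ⟨hsrc, -, hε⟩ := S.coord_of_mem_stableSet hzs hge
  exact ⟨hsrc, by linarith [S.eps_pos]⟩

/-- **`N` is open in the slab.** [folklore] -/
theorem isOpen_normalRegion : IsOpen (S.normalRegion t₁) := by
  have hfc : Continuous f := S.contMDiff_f.continuous
  have hfX : Continuous fun z : S.slab t₁ => f z.1 := hfc.comp continuous_subtype_val
  have hBo : IsOpen {z : c.W | z ∈ S.box.chart.source ∧ ‖S.box.coord z‖ < 2 * S.ε} :=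
    S.box.continuousOn_coord.isOpen_inter_preimage S.box.chart.open_source
      (isOpen_lt continuous_norm continuous_const)
  rw [isOpen_iff_mem_nhds]
  intro z hz
  rcases lt_trichotomy (f z.1) S.b' with hlt | heq | hgt
  · -- below `V₋ε`
    have hA : {w : S.slab t₁ | levelProj S.θ f S.b' w.1 ∈ S.chartRegion} ∈ 𝓝 z :=
      ((S.continuousAt_levelProj_b' ⟨z.2.1, hlt.le⟩).comp continuous_subtype_val.continuousAt).preimage_mem_nhds
        (S.isOpen_chartRegion.mem_nhds (hz.1 hlt.le))
    filter_upwards [hA, (isOpen_lt hfX continuous_const).mem_nhds hlt] with w hw hwlt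
    exact ⟨fun _ => hw, fun hge => absurd hge (not_le.2 hwlt)⟩
  · -- on `V₋ε`
    have hA : {w : S.slab t₁ | levelProj S.θ f S.b' w.1 ∈ S.chartRegion} ∈ 𝓝 z :=
      ((S.continuousAt_levelProj_b' ⟨z.2.1, heq.le⟩).comp continuous_subtype_val.continuousAt).preimage_mem_nhds
        (S.isOpen_chartRegion.mem_nhds (hz.1 heq.le))
    have hB : {w : S.slab t₁ | w.1 ∈ S.box.chart.source ∧ ‖S.box.coord w.1‖ < 2 * S.ε} ∈ 𝓝 z :=
      (hBo.preimage continuous_subtype_val).mem_nhds (hz.2 heq.ge)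
    filter_upwards [hA, hB] with w hw hw'
    exact ⟨fun _ => hw, fun _ => hw'⟩
  · -- above `V₋ε`
    have hB : {w : S.slab t₁ | w.1 ∈ S.box.chart.source ∧ ‖S.box.coord w.1‖ < 2 * S.ε} ∈ 𝓝 z :=
      (hBo.preimage continuous_subtype_val).mem_nhds (hz.2 hgt.le)
    filter_upwards [hB, (isOpen_lt continuous_const hfX).mem_nhds hgt] with w hw hwgt
    exact ⟨fun hle => absurd hle (not_le.2 hwgt), fun _ => hw⟩

/-! #### The transverse flat disc `ψ(0, y)` -/

variable (t₁)

/-- The radius of the flat disc: `r = min ε √(t₁ - f q)` (so that the disc lies in the box and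
in the slab `f ≤ t₁`). [folklore] -/
def flatRadius : ℝ := min S.ε (Real.sqrt (t₁ - f S.q))

variable {t₁}

/-- `0 < r` when `f q < t₁`. [folklore] -/
theorem flatRadius_pos (ht₁ : f S.q < t₁) : 0 < S.flatRadius t₁ :=
  lt_min S.eps_pos (Real.sqrt_pos.2 (by linarith))

/-- `r ≤ ε`. [folklore] -/
theorem flatRadius_le_eps : S.flatRadius t₁ ≤ S.ε := min_le_left _ _

/-- `r² ≤ t₁ - f q` when `f q < t₁`. [folklore] -/
theorem flatRadius_sq_le (ht₁ : f S.q < t₁) : S.flatRadius t₁ ^ 2 ≤ t₁ - f S.q := by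
  have h1 : S.flatRadius t₁ ≤ Real.sqrt (t₁ - f S.q) := min_le_right _ _
  have h0 : 0 ≤ S.flatRadius t₁ := (S.flatRadius_pos ht₁).le
  calc S.flatRadius t₁ ^ 2 ≤ Real.sqrt (t₁ - f S.q) ^ 2 := pow_le_pow_left₀ h0 h1 2
    _ = t₁ - f S.q := Real.sq_sqrt (by linarith)

/-- **The flat point `ψ(0, y)` in `W`.** [cite: MilnorHCobordism1965, Def. 3.1 (2) (PDF p. 12)] -/
def flatPointW (y : 𝔼ˡ) : c.W := S.chartPoint (upperEmb (k + 1) l (n + 1) y)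

/-- `‖(0, y)‖ = ‖y‖`. [folklore] -/
theorem norm_upperEmb_eq (hl : k + 1 + l = n + 1) (y : 𝔼ˡ) : ‖upperEmb (k + 1) l (n + 1) y‖ = ‖y‖ :=
  norm_upperEmb hl y

/-- For `‖y‖ ≤ ε`: `ψ(0, y)` lies in the chart domain, has coordinates `(0, y)`, and
`f (ψ(0, y)) = f q + ‖y‖²`. [cite: MilnorHCobordism1965, Def. 3.1 (2) (PDF p. 12)] -/
theorem flatPointW_spec (hl : k + 1 + l = n + 1) {y : 𝔼ˡ} (hy : ‖y‖ ≤ S.ε) :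
    S.flatPointW y ∈ S.box.chart.source ∧ S.box.coord (S.flatPointW y) = upperEmb (k + 1) l (n + 1) y ∧
      f (S.flatPointW y) = f S.q + ‖y‖ ^ 2 := by
  have h3 : ‖upperEmb (k + 1) l (n + 1) y‖ ≤ 3 * S.ε := by
    rw [norm_upperEmb_eq hl]; linarith [S.eps_pos]
  exact ⟨S.chartPoint_mem_source h3, S.coord_chartPoint h3,
    by rw [flatPointW, S.apply_chartPoint h3, milnorQuadratic_upperEmb hl]⟩

/-- `ψ(0, y)`, `‖y‖ ≤ r`, lies in the slab `f⁻¹[b, t₁]`. [folklore] -/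
theorem flatPointW_mem_slab (hl : k + 1 + l = n + 1) (ht₁ : f S.q < t₁) {y : 𝔼ˡ} (hy : ‖y‖ ≤ S.flatRadius t₁) :
    f (S.flatPointW y) ∈ Icc S.b t₁ := by
  rw [(S.flatPointW_spec hl (hy.trans S.flatRadius_le_eps)).2.2]
  have h1 : ‖y‖ ^ 2 ≤ S.flatRadius t₁ ^ 2 := pow_le_pow_left₀ (norm_nonneg y) hy 2
  have h2 := S.flatRadius_sq_le ht₁
  constructor
  · nlinarith [S.b_lt_b', S.b'_lt, norm_nonneg y]
  · linarith

variable (t₁)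

/-- **The transverse flat disc `m : ℝˡ → X`**: `y ↦ ψ(0, clip_r y)` (so that `m` is defined and
continuous everywhere and agrees with `ψ(0, ·)` on `B̄(0, r)`). [cite: MilnorHCobordism1965, Def. 3.1 (2) (PDF p. 12), proof of Lemma 7.2 (PDF p. 47)] -/
def flatPoint (hl : k + 1 + l = n + 1) (ht₁ : f S.q < t₁) (y : 𝔼ˡ) : S.slab t₁ :=
  ⟨S.flatPointW (radialClip (S.flatRadius t₁) y),
    S.flatPointW_mem_slab hl ht₁ (norm_radialClip_le (S.flatRadius_pos ht₁) y)⟩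

variable {t₁}

/-- On `B̄(0, r)`, `m y = ψ(0, y)`. [folklore] -/
theorem coe_flatPoint (hl : k + 1 + l = n + 1) (ht₁ : f S.q < t₁) {y : 𝔼ˡ} (hy : ‖y‖ ≤ S.flatRadius t₁) :
    (S.flatPoint t₁ hl ht₁ y : c.W) = S.flatPointW y := by
  change S.flatPointW (radialClip (S.flatRadius t₁) y) = _
  rw [radialClip_of_norm_le (S.flatRadius_pos ht₁) hy]

/-- `m 0 = q`. [folklore] -/
theorem coe_flatPoint_zero (hl : k + 1 + l = n + 1) (ht₁ : f S.q < t₁) :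
    (S.flatPoint t₁ hl ht₁ 0 : c.W) = S.q := by
  rw [S.coe_flatPoint hl ht₁ (by rw [norm_zero]; exact (S.flatRadius_pos ht₁).le), flatPointW, map_zero]
  exact S.chartPoint_zero

/-- `m` is continuous. [folklore] -/
theorem continuous_flatPoint (hl : k + 1 + l = n + 1) (ht₁ : f S.q < t₁) : Continuous (S.flatPoint t₁ hl ht₁) := by
  have hr := S.flatRadius_pos ht₁
  refine Continuous.subtype_mk ?_ _
  have h1 : Continuous fun y : 𝔼ˡ => upperEmb (k + 1) l (n + 1) (radialClip (S.flatRadius t₁) y) :=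
    (upperEmb (k + 1) l (n + 1)).continuous.comp (continuous_radialClip hr)
  refine continuous_iff_continuousAt.2 fun y => ?_
  have h3 : ‖upperEmb (k + 1) l (n + 1) (radialClip (S.flatRadius t₁) y)‖ < 3 * S.ε := by
    rw [norm_upperEmb_eq hl]
    linarith [norm_radialClip_le hr y, S.flatRadius_le_eps (t₁ := t₁), S.eps_pos]
  change ContinuousAt (fun y => S.chartPoint (upperEmb (k + 1) l (n + 1) (radialClip (S.flatRadius t₁) y))) y
  exact ContinuousAt.comp (f := fun y => upperEmb (k + 1) l (n + 1) (radialClip (S.flatRadius t₁) y))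
    (S.contMDiffAt_chartPoint h3).continuousAt h1.continuousAt

/-- `m` is injective on `B̄(0, r)` (its points have distinct Milnor coordinates). [folklore] -/
theorem injOn_flatPoint (hl : k + 1 + l = n + 1) (ht₁ : f S.q < t₁) :
    InjOn (S.flatPoint t₁ hl ht₁) (closedBall 0 (S.flatRadius t₁)) := by
  intro y₁ hy₁ y₂ hy₂ h
  have h₁ : ‖y₁‖ ≤ S.flatRadius t₁ := mem_closedBall_zero_iff.1 hy₁
  have h₂ : ‖y₂‖ ≤ S.flatRadius t₁ := mem_closedBall_zero_iff.1 hy₂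
  have h' := congrArg (fun z : S.slab t₁ => S.box.coord (z : c.W)) h
  simp only [S.coe_flatPoint hl ht₁ h₁, S.coe_flatPoint hl ht₁ h₂,
    (S.flatPointW_spec hl (h₁.trans S.flatRadius_le_eps)).2.1,
    (S.flatPointW_spec hl (h₂.trans S.flatRadius_le_eps)).2.1] at h'
  have h'' := congrArg (upperProj (k + 1) l (n + 1)) h'
  rwa [upperProj_upperEmb hl.le, upperProj_upperEmb hl.le] at h''

/-- The flat points lie above `V₋ε` (indeed `f ≥ f q`). [folklore] -/
theorem b'_lt_apply_flatPoint (hl : k + 1 + l = n + 1) (ht₁ : f S.q < t₁) (y : 𝔼ˡ) :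
    S.b' < f (S.flatPoint t₁ hl ht₁ y : c.W) := by
  change S.b' < f (S.flatPointW (radialClip (S.flatRadius t₁) y))
  rw [(S.flatPointW_spec hl ((norm_radialClip_le (S.flatRadius_pos ht₁) y).trans S.flatRadius_le_eps)).2.2]
  nlinarith [S.b'_lt, norm_nonneg (radialClip (S.flatRadius t₁) y)]

/-- **The flat disc lies in `N`.** [folklore] -/
theorem flatPoint_mem_normalRegion (hl : k + 1 + l = n + 1) (ht₁ : f S.q < t₁) (y : 𝔼ˡ) :
    S.flatPoint t₁ hl ht₁ y ∈ S.normalRegion t₁ := by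
  have hr := S.flatRadius_pos ht₁
  have hy := norm_radialClip_le hr y
  have hspec := S.flatPointW_spec hl (hy.trans S.flatRadius_le_eps)
  refine ⟨fun hle => absurd hle (not_le.2 (S.b'_lt_apply_flatPoint hl ht₁ y)), fun _ => ⟨hspec.1, ?_⟩⟩
  change ‖S.box.coord (S.flatPointW (radialClip (S.flatRadius t₁) y))‖ < 2 * S.ε
  rw [hspec.2.1, norm_upperEmb_eq hl]
  linarith [S.flatRadius_le_eps (t₁ := t₁), S.eps_pos]

/-- **`K ∘ m = id` on `B̄(0, r)`**: the normal coordinate of `ψ(0, y)` is `y`. [cite: MilnorHCobordism1965, Def. 3.1 (2) (PDF p. 12)] -/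
theorem normalCoordW_flatPoint (hl : k + 1 + l = n + 1) (ht₁ : f S.q < t₁) {y : 𝔼ˡ} (hy : ‖y‖ ≤ S.flatRadius t₁) :
    S.normalCoordW (l := l) (S.flatPoint t₁ hl ht₁ y : c.W) = y := by
  rw [normalCoordW, S.chartOf_of_lt (S.b'_lt_apply_flatPoint hl ht₁ y), S.coe_flatPoint hl ht₁ hy,
    (S.flatPointW_spec hl (hy.trans S.flatRadius_le_eps)).2.1, upperProj_upperEmb hl.le]

/-- **The flat disc lies in the unstable set of `q`** (in the box the unstable set is `x⃗ = 0`). [cite: MilnorHCobordism1965, Def. 3.1 (2) (PDF p. 12), Def. 3.9 (PDF p. 16)] -/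
theorem flatPoint_mem_unstableSet (hD : S.box.chart.source ⊆ f ⁻¹' Ioo S.a₀ S.a₁) (hl : k + 1 + l = n + 1) (ht₁ : f S.q < t₁) (y : 𝔼ˡ) :
    (S.flatPoint t₁ hl ht₁ y : c.W) ∈ unstableSet (𝓡∂ (n + 1)) ξ S.q := by
  have hr := S.flatRadius_pos ht₁
  set y' := radialClip (S.flatRadius t₁) y with hy'
  have hy : ‖y'‖ ≤ S.flatRadius t₁ := norm_radialClip_le hr y
  have hspec := S.flatPointW_spec hl (hy.trans S.flatRadius_le_eps)
  have hε := S.eps_pos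
  have hbox : S.flatPointW y' ∈ S.box.box := by
    refine ⟨hspec.1, ?_, ?_⟩
    · rw [hspec.2.1, S.box_k, sqSumLT_upperEmb hl]; positivity
    · rw [hspec.2.1, S.box_k, sqSumGE_upperEmb hl]
      have : ‖y'‖ ^ 2 ≤ S.ε ^ 2 := pow_le_pow_left₀ (norm_nonneg _) (hy.trans S.flatRadius_le_eps) 2
      nlinarith
  have h := S.pre.box_inter_unstableSet_eq S.box hD
  have hmem : S.flatPointW y' ∈ S.box.box ∩ {w | sqSumLT S.box.k (S.box.coord w) = 0} :=
    ⟨hbox, by show sqSumLT S.box.k (S.box.coord (S.flatPointW y')) = 0; rw [hspec.2.1, S.box_k, sqSumLT_upperEmb hl]⟩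
  rw [← h] at hmem
  exact hmem.2

/-- **A point of the unstable set in the small Milnor ball is a flat point**: if `z ∈ D.box`,
`‖(x⃗, y⃗)(z)‖ ≤ r` and `z` lies on a trajectory coming from `q`, then `z = ψ(0, y⃗(z))`. [cite: MilnorHCobordism1965, Def. 3.1 (2) (PDF p. 12), Def. 3.9 (PDF p. 16)] -/
theorem eq_flatPointW_of_mem_unstableSet (hD : S.box.chart.source ⊆ f ⁻¹' Ioo S.a₀ S.a₁) (hl : k + 1 + l = n + 1) {z : c.W}
    (hzb : z ∈ S.box.box) (hzu : z ∈ unstableSet (𝓡∂ (n + 1)) ξ S.q) :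
    z = S.flatPointW (upperProj (k + 1) l (n + 1) (S.box.coord z)) := by
  have h := S.pre.box_inter_unstableSet_eq S.box hD
  have hmem : z ∈ S.box.box ∩ {w | sqSumLT S.box.k (S.box.coord w) = 0} := by rw [← h]; exact ⟨hzb, hzu⟩
  have h0 : sqSumLT (k + 1) (S.box.coord z) = 0 := by rw [← S.box_k]; exact hmem.2
  have hu := eq_upperEmb_of_sqSumLT_eq_zero hl h0
  calc z = S.chartPoint (S.box.coord z) := (S.chartPoint_coord hzb.1).symm
    _ = _ := by rw [flatPointW, ← hu]

/-! #### Closedness of the left-hand disc -/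

/-- **The left-hand disc `D_L(q) = stableSet ∩ {b ≤ f}` is closed** (it is an embedded closed
disc, `LeftSphereSetting.exists_continuousMap_range_eq_leftHandDisc`). [cite: MilnorHCobordism1965, Def. 3.9 (PDF p. 16)] -/
theorem isClosed_leftHandDisc : IsClosed (leftHandDisc (𝓡∂ (n + 1)) f ξ S.q S.b) := by
  obtain ⟨Φ, -, hrange, -⟩ := S.exists_continuousMap_range_eq_leftHandDisc
  rw [← hrange]
  haveI : CompactSpace (closedBall (0 : EuclideanSpace ℝ (Fin (k + 1))) 1) :=
    isCompact_iff_compactSpace.1 (isCompact_closedBall _ _)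
  exact (isCompact_range Φ.continuous).isClosed

/-! ### The transverse disc datum -/

/-- **The transverse disc datum of the left-hand disc across the slab `f⁻¹[b, t₁]`** (`f q < t₁`,
chart domain in the open slab, `(k + 1) + l = n + 1`): stratum `P = D_L(q)` (the stable set of `q`,
on the slab), neighbourhood `N`, normal coordinate `clip_r ∘ y⃗ ∘ chartOf`, transverse disc
`y ↦ ψ(0, y)` of radius `r`. [cite: MilnorHCobordism1965, proof of Lemma 7.2 (PDF p. 47), Def. 3.1 (2), Def. 3.9 (PDF pp. 12, 16)] -/
def transverseDiscDatum (hD : S.box.chart.source ⊆ f ⁻¹' Ioo S.a₀ S.a₁) (hl : k + 1 + l = n + 1) (ht₁ : f S.q < t₁) :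
    TransverseDiscDatum (S.slab t₁) l where
  P := Subtype.val ⁻¹' stableSet (𝓡∂ (n + 1)) ξ S.q
  N := S.normalRegion t₁
  isClosed_P := by
    have h : (Subtype.val ⁻¹' stableSet (𝓡∂ (n + 1)) ξ S.q : Set (S.slab t₁)) =
        Subtype.val ⁻¹' leftHandDisc (𝓡∂ (n + 1)) f ξ S.q S.b := by
      ext z
      simp only [mem_preimage, mem_leftHandDisc_iff]
      exact ⟨fun hz => ⟨hz, z.2.1⟩, fun hz => hz.1⟩
    rw [h]
    exact S.isClosed_leftHandDisc.preimage continuous_subtype_val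
  isOpen_N := S.isOpen_normalRegion
  subset := fun z hz => S.mem_normalRegionW_of_mem_stableSet hz z.2.1
  m := S.flatPoint t₁ hl ht₁
  r := S.flatRadius t₁
  r_pos := S.flatRadius_pos ht₁
  continuousOn_m := (S.continuous_flatPoint hl ht₁).continuousOn
  injOn_m := S.injOn_flatPoint hl ht₁
  K := ⟨fun z => radialClip (S.flatRadius t₁) (S.normalCoordW (l := l) (z : c.W)),
    (continuous_radialClip (S.flatRadius_pos ht₁)).comp
      (S.continuousOn_normalCoordW.comp_continuous (continuous_subtype_val.comp continuous_subtype_val)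
        fun z => ⟨z.2, z.1.2.1⟩)⟩
  norm_le := fun z => norm_radialClip_le (S.flatRadius_pos ht₁) _
  eq_zero_iff := fun z => by
    change radialClip (S.flatRadius t₁) (S.normalCoordW (l := l) (z : c.W)) = 0 ↔ _
    rw [radialClip_eq_zero_iff (S.flatRadius_pos ht₁)]
    exact S.normalCoordW_eq_zero_iff hD hl z.2 z.1.2.1

section Datum

variable (hD : S.box.chart.source ⊆ f ⁻¹' Ioo S.a₀ S.a₁) (hl : k + 1 + l = n + 1) (ht₁ : f S.q < t₁)

/-- The stratum of the datum is the stable set (the left-hand disc). [folklore] -/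
@[simp] theorem transverseDiscDatum_P :
    (S.transverseDiscDatum hD hl ht₁).P = Subtype.val ⁻¹' stableSet (𝓡∂ (n + 1)) ξ S.q := rfl

/-- The neighbourhood of the datum is `N`. [folklore] -/
@[simp] theorem transverseDiscDatum_N : (S.transverseDiscDatum hD hl ht₁).N = S.normalRegion t₁ := rfl

/-- The disc of the datum is the flat disc. [folklore] -/
@[simp] theorem transverseDiscDatum_m : (S.transverseDiscDatum hD hl ht₁).m = S.flatPoint t₁ hl ht₁ := rfl

/-- The radius of the datum. [folklore] -/
@[simp] theorem transverseDiscDatum_r : (S.transverseDiscDatum hD hl ht₁).r = S.flatRadius t₁ := rfl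

/-- **The normal coordinate of the datum**: `K z = clip_r (y⃗ (chartOf z))`. [folklore] -/
theorem transverseDiscDatum_K_apply (z : ↥(S.transverseDiscDatum hD hl ht₁).N) :
    (S.transverseDiscDatum hD hl ht₁).K z = radialClip (S.flatRadius t₁) (S.normalCoordW (l := l) (z : c.W)) := rfl

/-- **Below `V₋ε` the normal coordinate is `clip_r (y⃗ (translate to V₋ε))`.** [cite: MilnorHCobordism1965, Def. 3.9 (PDF p. 16)] -/
theorem K_apply_of_apply_le (z : ↥(S.transverseDiscDatum hD hl ht₁).N) (hz : f (z : c.W) ≤ S.b') :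
    (S.transverseDiscDatum hD hl ht₁).K z =
      radialClip (S.flatRadius t₁) (upperProj (k + 1) l (n + 1) (S.box.coord (levelProj S.θ f S.b' (z : c.W)))) := by
  rw [transverseDiscDatum_K_apply, normalCoordW, S.chartOf_of_le hz]

/-- The centre of the datum is `q`. [folklore] -/
theorem coe_centre : (((S.transverseDiscDatum hD hl ht₁).centre : S.slab t₁) : c.W) = S.q :=
  S.coe_flatPoint_zero hl ht₁

/-- **`K ∘ m = id` on `B̄(0, r)`.** [cite: MilnorHCobordism1965, Def. 3.1 (2) (PDF p. 12)] -/
theorem K_flatPoint (hDN : (S.transverseDiscDatum hD hl ht₁).disc ⊆ (S.transverseDiscDatum hD hl ht₁).N)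
    (v : 𝔼ˡ) (hv : v ∈ closedBall (0 : 𝔼ˡ) (S.transverseDiscDatum hD hl ht₁).r) :
    (S.transverseDiscDatum hD hl ht₁).K ⟨(S.transverseDiscDatum hD hl ht₁).m v, hDN (mem_image_of_mem _ hv)⟩ = v := by
  have hv' : ‖v‖ ≤ S.flatRadius t₁ := mem_closedBall_zero_iff.1 hv
  rw [transverseDiscDatum_K_apply]
  change radialClip (S.flatRadius t₁) (S.normalCoordW (l := l) (S.flatPoint t₁ hl ht₁ v : c.W)) = v
  rw [S.normalCoordW_flatPoint hl ht₁ hv', radialClip_of_norm_le (S.flatRadius_pos ht₁) hv']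

/-- **The flat disc lies in `N`.** [folklore] -/
theorem disc_subset_N : (S.transverseDiscDatum hD hl ht₁).disc ⊆ (S.transverseDiscDatum hD hl ht₁).N := by
  rintro _ ⟨v, -, rfl⟩
  exact S.flatPoint_mem_normalRegion hl ht₁ v

/-- **The flat disc lies in the unstable set of `q`** (the right-hand disc). [cite: MilnorHCobordism1965, Def. 3.9 (PDF p. 16)] -/
theorem disc_subset_unstableSet :
    (S.transverseDiscDatum hD hl ht₁).disc ⊆ Subtype.val ⁻¹' unstableSet (𝓡∂ (n + 1)) ξ S.q := by
  rintro _ ⟨v, -, rfl⟩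
  exact S.flatPoint_mem_unstableSet hD hl ht₁ v

/-- **The flat disc is a neighbourhood of `q` in the unstable set** (within the slab): the points
of `D_R(q)` in the Milnor ball of radius `r` are flat points. [cite: MilnorHCobordism1965, Def. 3.1 (2), Def. 3.9 (PDF pp. 12, 16)] -/
theorem disc_mem_nhdsWithin :
    (S.transverseDiscDatum hD hl ht₁).disc ∈
      𝓝[Subtype.val ⁻¹' unstableSet (𝓡∂ (n + 1)) ξ S.q] ((S.transverseDiscDatum hD hl ht₁).m 0) := by
  have hr := S.flatRadius_pos ht₁
  -- the open set `O = {z ∈ box | ‖coord z‖ < r}` of `W`, pulled back to the slab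
  set O : Set c.W := S.box.box ∩ {z | z ∈ S.box.chart.source ∧ ‖S.box.coord z‖ < S.flatRadius t₁} with hO
  have hOo : IsOpen O := S.box.isOpen_box.inter
    (S.box.continuousOn_coord.isOpen_inter_preimage S.box.chart.open_source
      (isOpen_lt continuous_norm continuous_const))
  have hqO : ((S.transverseDiscDatum hD hl ht₁).m 0 : c.W) ∈ O := by
    rw [transverseDiscDatum_m, S.coe_flatPoint_zero hl ht₁]
    exact ⟨S.box.mem_box_self, S.box.mem_source, by rw [MilnorBox.coord_self, norm_zero]; exact hr⟩
  have hOX : (Subtype.val ⁻¹' O : Set (S.slab t₁)) ∈ 𝓝 ((S.transverseDiscDatum hD hl ht₁).m 0) :=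
    (hOo.preimage continuous_subtype_val).mem_nhds hqO
  refine mem_nhdsWithin_iff_exists_mem_nhds_inter.2 ⟨_, hOX, ?_⟩
  rintro z ⟨⟨hzb, -, hzr⟩, hzu⟩
  have hzu' : (z : c.W) ∈ unstableSet (𝓡∂ (n + 1)) ξ S.q := hzu
  set v := upperProj (k + 1) l (n + 1) (S.box.coord (z : c.W)) with hv
  have hzv := S.eq_flatPointW_of_mem_unstableSet hD hl hzb hzu'
  have hvn : ‖v‖ ≤ S.flatRadius t₁ := by
    have h0 : sqSumLT (k + 1) (S.box.coord (z : c.W)) = 0 := by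
      have h := S.pre.box_inter_unstableSet_eq S.box hD
      have hmem : (z : c.W) ∈ S.box.box ∩ {w | sqSumLT S.box.k (S.box.coord w) = 0} := by
        rw [← h]; exact ⟨hzb, hzu'⟩
      rw [← S.box_k]; exact hmem.2
    have hu := eq_upperEmb_of_sqSumLT_eq_zero hl h0
    have : ‖S.box.coord (z : c.W)‖ = ‖v‖ := by rw [hu, norm_upperEmb_eq hl]
    rw [← this]; exact hzr.le
  refine ⟨v, mem_closedBall_zero_iff.2 hvn, Subtype.ext ?_⟩
  rw [transverseDiscDatum_m, S.coe_flatPoint hl ht₁ hvn]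
  exact hzv.symm

/-- **`D_L(q) ∩ D_R(q) = {q}` on the slab**: a point of the unstable set lying on the stratum is
the centre. [cite: MilnorHCobordism1965, Def. 3.9 (PDF p. 16)] -/
theorem eq_centre_of_mem_unstableSet_of_mem_P {z : S.slab t₁}
    (hzu : z ∈ (Subtype.val ⁻¹' unstableSet (𝓡∂ (n + 1)) ξ S.q : Set (S.slab t₁)))
    (hzs : z ∈ (S.transverseDiscDatum hD hl ht₁).P) : (z : c.W) = (S.transverseDiscDatum hD hl ht₁).m 0 := by
  rw [transverseDiscDatum_m, S.coe_flatPoint_zero hl ht₁]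
  exact S.eq_q_of_mem_stableSet_of_mem_unstableSet hzs hzu (S.lt_b.le.trans z.2.1)

/-- **`N` near the lower level**: a point of the slab with `f < b'` lies in `N` iff its translate
to `V₋ε` lies in the chart region. [folklore] -/
theorem mem_N_iff_of_apply_lt {z : S.slab t₁} (hz : f (z : c.W) < S.b') :
    z ∈ (S.transverseDiscDatum hD hl ht₁).N ↔ levelProj S.θ f S.b' (z : c.W) ∈ S.chartRegion := by
  change (z : c.W) ∈ S.normalRegionW ↔ _
  exact ⟨fun h => h.1 hz.le, fun h => ⟨fun _ => h, fun hge => absurd hge (not_le.2 hz)⟩⟩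

end Datum

/-! #### Link with the product neighbourhood `φ_L` of the lower level -/

/-- **The normal component of `paramInv` is the normal coordinate**: for a presentation `ι` of the
level `b`, `(paramInv ι v).2 = y⃗ (translate of ι v to V₋ε)` (by definition). [cite: MilnorHCobordism1965, Def. 3.9 (PDF p. 16)] -/
theorem snd_paramInv {V : Type u} (ι : V → c.W) (v : V) :
    (S.paramInv ι v).2 = upperProj (k + 1) (n - k) (n + 1) (S.box.coord (levelProj S.θ f S.b' (ι v))) := rfl

end LeftSphereSetting

end Cobordism

end Setting

end Literature.Topology.FourManifolds

end
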